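import Summits.CriticalPhenomena.SAWScalingLimit.Theorems.SAWDevelopingMapHexConjectureArchTailSummed
import Summits.CriticalPhenomena.SAWScalingLimit.Theorems.SAWDevelopingMapHexConjectureTriangleChart
import Summits.CriticalPhenomena.SAWScalingLimit.Theorems.SAWDevelopingMapHexConjectureTriangleArchTransfer
import HarnessLib

/-!
# Crux `HexConjecture` (stmt-CriticalPhenomena-0808), line `root-locality-replaces-loewner` (lead c8):
the two-point TAIL bound — floor arch masses beyond offset `L` weigh at most the triangle tail

Landing target:
`Summits/CriticalPhenomena/SAWScalingLimit/Theorems/SAWDevelopingMapHexConjectureTwoPointTailBound.lean`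
(`--supports stmt-CriticalPhenomena-0808`; registered stub `stub_farOffsetMass_le_sub_triA`).

Krachun–Panagiotis 2023, Lemma 2.2 (second part): `Σ_{k ≥ T} G_k ≤ (cos(π/8)/(2cos(3π/8))) D_{2T−1}` — the
half-plane boundary two-point function summed beyond distance `T` is at most the triangle tail, because an arch
ending beyond the base of the inscribed triangle is an arch of the half-plane not contained in the triangle, and
those weigh `1/cos(3π/8) − A^Δ = (cos(π/8)/cos(3π/8)) D^Δ` by the triangle identity (Glazman–Manolescu Lemma 4.1)
and the strip identity (Duminil-Copin–Smirnov Lemma 2).  In the tree's vocabulary (finite domains `Λ` above the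
floor through the vertical floor mid-edge `s_x`, floor mid-edges `t_{x + d e₀}`):

  `Σ_{d ∈ S} Z_Λ(s_x → t_{x + d e₀}) ≤ 1/cos(3π/8) − A^Δ(L)`   whenever `|d| ≥ L + 1` on `S`   (`farOffsetMass_le_sub_triA`).

With `inv_cos_sub_triA_eq_two_mul` (`…FarSideTriangleTail.lean`) the right-hand side is `2(cos(π/8)/cos(3π/8))·triDl L`.
For the line this is the UPPER companion of the window two-point lower bound WTLB (`…AspectBoundOfWindowTwoPoint.lean`):
the reference-window mass `Σ_{d ∈ [θa R, θb R]} Z_B(s_x → t_d)` lies between `c·triDl(⌊R/4⌋)` (WTLB, open; cube version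
proved) and `2(1+√2)·triDl(⌈θa R⌉ − 1)` (this file) — WTLB is an order-of-magnitude doubling statement about ONE sequence.
Sources: arXiv:2310.17299 (Lemma 2.2), GlazmanManolescu2019 (Lemma 4.1), DuminilCopinSmirnov2012 (Lemma 2, §3).
-/

noncomputable section

open scoped BigOperators Topology Classical
open Filter Set
open Literature.Probability.LatticeModels (HexVertex hexGraph hexCenter Site)
open Literature.Probability.RandomPlanarGeometry
open Literature.Probability.RandomPlanarGeometry.SAW
open Literature.Probability.RandomPlanarGeometry.SAW.HV
open Summit.CriticalPhenomena.SAWScalingLimit.Theorems.ObservableToSLE.FloorRatio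

namespace Summit.CriticalPhenomena.SAWScalingLimit.Theorems.HexConjecture.RootLocality


/-- **THE TWO-POINT TAIL BOUND.**  For every cell `x`, every finite `Λ` in the rows `≥ x₁`, every `L` and every
finite set `S` of offsets with `|d| ≥ L + 1`: `Σ_{d ∈ S} Z_Λ(s_x → t_{x + d e₀}) ≤ 1/cos(3π/8) − A^Δ(L)`.  The arches to
offsets beyond `±L` and the arches of the inscribed triangle `T_x(L)` (which exit at non-zero offsets `|d| ≤ L` and
weigh at least `A^Δ(L)`, `stub_triA_le_sum_archMass_triChart`) are disjoint families of floor arches of a common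
half-strip `S_x(N)`, whose total floor-arch mass is at most `1/cos(3π/8)` (`archTotal_le`).
[cite: GlazmanManolescu2019, Lemma 4.1; DuminilCopinSmirnov2012, Lemma 2 and §3 ("A_{T,L} ≤ 1/c_α")] -/
theorem farOffsetMass_le_sub_triA (x : Site 2) (Λ : Finset HexVertex) (hΛ : ∀ v ∈ Λ, x 1 ≤ v.1 1)
    (L : ℕ) (S : Finset ℤ) (hS : ∀ d ∈ S, (L : ℤ) + 1 ≤ |d|) :
    ∑ d ∈ S, ∑ γ : HexMidEdgeSAW Λ s((x - Pi.single 1 1, 1), (x, 0))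
        s((x + Pi.single 0 d - Pi.single 1 1, 1), (x + Pi.single 0 d, 0)), hexCriticalFugacity ^ γ.length ≤
      (Real.cos (3 * Real.pi / 8))⁻¹ - triA L := by
  -- a half-strip containing `Λ` and the triangle, whose offset window contains `S`
  set N₀ : ℕ := 2 * L + ∑ d ∈ S, (|d|).toNat with hN₀
  obtain ⟨N, hN₀N, hΛN⟩ := exists_subset_halfStrip Λ x hΛ N₀
  have hLN : 2 * L ≤ N := le_trans (Nat.le_add_right _ _) hN₀N
  set Φ := (hvIso.trans (shift (-(x 0)) (-(x 1)))).symm.toEquiv.toEmbedding with hΦ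
  set HSN := (stripV (N + 1) (N + 1)).map Φ with hHSN
  set HT := (triV L).map Φ with hHT
  set DN := (Finset.Icc (-((N : ℤ) + 1)) ((N : ℤ) + 1)).erase 0 with hDN
  set DL := (Finset.Icc (-(L : ℤ)) (L : ℤ)).erase 0 with hDL
  set s : Sym2 HexVertex := s((x - Pi.single 1 1, 1), (x, 0)) with hs
  set Z : Finset HexVertex → ℤ → ℝ := fun Λ' d => ∑ γ : HexMidEdgeSAW Λ' s
      s((x + Pi.single 0 d - Pi.single 1 1, 1), (x + Pi.single 0 d, 0)), hexCriticalFugacity ^ γ.length with hZ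
  have hSD : S ⊆ DN := by
    intro d hd
    rw [hDN, mem_offsetWindow_iff]
    have hLd := hS d hd
    refine ⟨fun h => by subst h; simp at hLd; omega, ?_⟩
    have h1 : (|d|).toNat ≤ ∑ d' ∈ S, (|d'|).toNat :=
      Finset.single_le_sum (f := fun d' : ℤ => (|d'|).toNat) (fun _ _ => Nat.zero_le _) hd
    have h2 : (|d| : ℤ) = ((|d|).toNat : ℤ) := (Int.toNat_of_nonneg (abs_nonneg d)).symm
    have h3 : ((|d|).toNat : ℤ) ≤ N := by exact_mod_cast h1.trans ((Nat.le_add_left _ _).trans hN₀N)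
    omega
  have hDLN : DL ⊆ DN := by
    intro d hd
    rw [hDL, Finset.mem_erase, Finset.mem_Icc] at hd
    rw [hDN, Finset.mem_erase, Finset.mem_Icc]
    exact ⟨hd.1, by omega, by omega⟩
  have hdisj : Disjoint S DL := by
    rw [Finset.disjoint_left]
    intro d hdS hdL
    have h1 := hS d hdS
    rw [hDL, Finset.mem_erase, Finset.mem_Icc] at hdL
    have : |d| ≤ L := abs_le.2 ⟨hdL.2.1, hdL.2.2⟩
    omega
  have hZnn : ∀ Λ' d, 0 ≤ Z Λ' d := fun Λ' d => archMass_nonneg _ _ _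
  -- (1) monotonicity in the domain: `Λ ⊆ S_x(N)` and `T_x(L) ⊆ S_x(N)`
  have h1 : ∑ d ∈ S, Z Λ d ≤ ∑ d ∈ S, Z HSN d :=
    Finset.sum_le_sum fun d _ => archMass_mono hΛN s _
  have h2 : triA L ≤ ∑ d ∈ DL, Z HSN d :=
    (stub_triA_le_sum_archMass_triChart x L).trans (Finset.sum_le_sum fun d _ => archMass_mono (triChart_subset_halfStrip x hLN) s _)
  -- (2) the two offset families are disjoint parts of the window of `S_x(N)`
  have h3 : ∑ d ∈ S, Z HSN d + ∑ d ∈ DL, Z HSN d ≤ ∑ d ∈ DN, Z HSN d := by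
    rw [← Finset.sum_union hdisj]
    exact Finset.sum_le_sum_of_subset_of_nonneg (Finset.union_subset hSD hDLN) fun d _ _ => hZnn _ _
  -- (3) the total floor-arch mass of the half-strip is at most `1/cos(3π/8)`
  have h4 : ∑ d ∈ DN, Z HSN d ≤ (Real.cos (3 * Real.pi / 8))⁻¹ := by
    have e : ∀ d ∈ DN, Z HSN d = ∑ P ∈ (midWalks (stripV (N + 1) (N + 1))).filter
        (fun P => finalDart P = ((d, 0, false), (d, -1, true)) ∨
          finalDart P = ((d, -1, true), (d, 0, false))), hexCriticalFugacity ^ mwLen P :=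
      fun d hd => archMass_halfStrip_offset x N d (mem_offsetWindow_iff.1 hd).2
    rw [Finset.sum_congr rfl e]
    exact archTotal_le N
  show ∑ d ∈ S, Z Λ d ≤ _
  linarith

/-- **Registered stub `stub_farOffsetMass_le_sub_triA`** (crux item stmt-CriticalPhenomena-0808, line
`root-locality-replaces-loewner`, lead c8): floor arch masses beyond offset `L` weigh at most the triangle tail
`1/cos(3π/8) − A^Δ(L)` (`farOffsetMass_le_sub_triA`; Krachun–Panagiotis Lemma 2.2 in the tree's vocabulary).
[cite: GlazmanManolescu2019, Lemma 4.1; DuminilCopinSmirnov2012, Lemma 2 and §3] -/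
theorem stub_farOffsetMass_le_sub_triA : ∀ (x : Literature.Probability.LatticeModels.Site 2) (Λ : Finset Literature.Probability.LatticeModels.HexVertex), (∀ v ∈ Λ, x 1 ≤ v.1 1) → ∀ (L : ℕ) (S : Finset ℤ), (∀ d ∈ S, (L : ℤ) + 1 ≤ |d|) → ∑ d ∈ S, ∑ γ : Literature.Probability.RandomPlanarGeometry.SAW.HexMidEdgeSAW Λ s((x - Pi.single 1 1, 1), (x, 0)) s((x + Pi.single 0 d - Pi.single 1 1, 1), (x + Pi.single 0 d, 0)), Literature.Probability.RandomPlanarGeometry.SAW.hexCriticalFugacity ^ γ.length ≤ (Real.cos (3 * Real.pi / 8))⁻¹ - Literature.Probability.RandomPlanarGeometry.SAW.HV.triA L :=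
  fun x Λ hΛ L S hS => farOffsetMass_le_sub_triA x Λ hΛ L S hS

end Summit.CriticalPhenomena.SAWScalingLimit.Theorems.HexConjecture.RootLocality

end
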